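import Mathlib
import Summits.Ventures.HodgeRepro2.T5SchurTensor
import Summits.Ventures.HodgeRepro2.T5SchurTensorEquivariance
import Summits.Ventures.HodgeRepro2.T5IsotypicHom
import Summits.Ventures.HodgeRepro2.T5HoweSmooth

/-!
# The universal property of `Θ(N) = Hom_R(N, V)`: `Hom_{R,R₂}(V, N ⊗ P) ≅ Hom_{R₂}(Θ(N), P)`

Blind cell `pub-hodge-repro2`, seat p8 (gen 6), Tier-5 kernel support for the N3 record
(MVW chap. 2 III.4: `S[π₁] ≅ π₁ ⊗ Θ(π₁)` and every `G₁ × G₂`-map `S[π₁] → π₁ ⊠ π₂` is `1 ⊗ t` for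
a unique `G₂`-map `t : Θ(π₁) → π₂`; §N3.12.4 (s3) / N3.10.3).  `T5HoweSmooth` (p393752) extracted
the `t` of a non-zero equivariant map into a SIMPLE `π₂`; this file records the full adjunction,
with no simplicity on `P`:

* `mapLeft` — `1 ⊗ t' : N ⊗[k] A →ₗ[R] N ⊗[k] B` for `k`-linear `t'` (the `R`-action on the
  left factor);
* `ofThetaHom t` — the equivariant map `V → N ⊗[k] P` attached to `t : Θ(N) →ₗ[R₂] P`:
  `ofThetaHom t (f n) = n ⊗ t f` (`ofThetaHom_apply`), `R`-linear and `R₂`-equivariant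
  (`ofThetaHom_equivariant`);
* `toThetaHom Φ` — the `R₂`-linear `t` attached to an `R`-linear `R₂`-equivariant `Φ`, with
  `Φ (f n) = n ⊗ toThetaHom Φ f` (`toThetaHom_spec`), unique (`eq_toThetaHom_of_spec`);
* `ofThetaHom_toThetaHom` / `toThetaHom_ofThetaHom` / `thetaEquiv` — **the bijection**
  `{Φ : V →ₗ[R] N ⊗[k] P // Φ is R₂-equivariant} ≃ (Θ(N) →ₗ[R₂] P)`.

Hypotheses as in `T5HoweSmooth`: `N` simple over `R` with `End_R(N) = k`, `V` semisimple
`N`-isotypic with a commuting `R₂`-action (`V = S[π₁]`: p393489 / p393644 / p393840).  What stays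
prose: the Hecke dictionary and the printed theorems.  Nothing arithmetic is asserted.

README §8(d): uses an L-value-free non-vanishing device: NO.
-/

namespace Summit.Ventures.HodgeRepro2.T5ThetaAdjunction

open Summit.Ventures.HodgeRepro2

section MapLeft

variable {k R : Type*} [Field k] [Ring R] [Algebra k R]
  {N : Type*} [AddCommGroup N] [Module R N] [Module k N] [IsScalarTower k R N]
  {A B : Type*} [AddCommGroup A] [Module k A] [AddCommGroup B] [Module k B]

/-- `1 ⊗ t' : N ⊗[k] A → N ⊗[k] B` as an `R`-linear map (`R` acting on the left factor). -/
def mapLeft (t' : A →ₗ[k] B) : TensorProduct k N A →ₗ[R] TensorProduct k N B where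
  toFun := TensorProduct.map LinearMap.id t'
  map_add' x y := map_add _ x y
  map_smul' r x := by
    induction x using TensorProduct.induction_on with
    | zero => simp
    | tmul n a =>
      rw [TensorProduct.smul_tmul', TensorProduct.map_tmul, TensorProduct.map_tmul,
        TensorProduct.smul_tmul']
      rfl
    | add x y hx hy =>
      rw [smul_add, map_add, hx, hy, map_add, smul_add]

/-- `mapLeft t' (n ⊗ a) = n ⊗ t' a`. -/
@[simp] theorem mapLeft_tmul (t' : A →ₗ[k] B) (n : N) (a : A) :
    mapLeft (R := R) t' (n ⊗ₜ[k] a) = n ⊗ₜ[k] t' a := by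
  change TensorProduct.map LinearMap.id t' (n ⊗ₜ[k] a) = n ⊗ₜ[k] t' a
  rw [TensorProduct.map_tmul]
  rfl

/-- `mapLeft t'` is `TensorProduct.map id t'` as a function. -/
theorem mapLeft_apply (t' : A →ₗ[k] B) (x : TensorProduct k N A) :
    mapLeft (R := R) t' x = TensorProduct.map LinearMap.id t' x := rfl

end MapLeft

section Adjunction

variable {k R R₂ : Type*} [Field k] [Ring R] [Algebra k R] [Ring R₂] [Algebra k R₂]
  {N : Type*} [AddCommGroup N] [Module R N] [Module k N] [IsScalarTower k R N]
  {V : Type*} [AddCommGroup V] [Module R V] [Module k V] [IsScalarTower k R V]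
  [Module R₂ V] [SMulCommClass R R₂ V] [SMulCommClass R₂ R V] [IsScalarTower k R₂ V]
  {P : Type*} [AddCommGroup P] [Module R₂ P] [Module k P] [IsScalarTower k R₂ P]
  [IsSimpleModule R N] (hSchur : ∀ φ : N →ₗ[R] N, ∃ c : k, ∀ x, φ x = c • x)
  [IsSemisimpleModule R V] (hV : IsIsotypicOfType R V N)

variable (R₂) in
/-- `Φ : V → N ⊗[k] P` is `R₂`-equivariant: `Φ (r • x) = (1 ⊗ (r • ·)) (Φ x)`. -/
def IsTensorEquivariant (Φ : V →ₗ[R] TensorProduct k N P) : Prop :=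
  ∀ (r : R₂) (x : V), Φ (r • x) = TensorProduct.map LinearMap.id (DistribSMul.toLinearMap k P r) (Φ x)

/-- **From `t` to `Φ`**: `ofThetaHom t = (1 ⊗ t) ∘ evEquiv⁻¹ : V → N ⊗[k] P`. -/
noncomputable def ofThetaHom (t : (N →ₗ[R] V) →ₗ[R₂] P) : V →ₗ[R] TensorProduct k N P :=
  haveI : Nontrivial N := IsSimpleModule.nontrivial R N
  (mapLeft (R := R) (t.restrictScalars k)) ∘ₗ
    ((T5IsotypicHom.evEquiv hSchur hV).symm : V →ₗ[R] TensorProduct k N (N →ₗ[R] V))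

omit [SMulCommClass R₂ R V] in
/-- `ofThetaHom t (f n) = n ⊗ t f`. -/
theorem ofThetaHom_apply (t : (N →ₗ[R] V) →ₗ[R₂] P) (n : N) (f : N →ₗ[R] V) :
    ofThetaHom hSchur hV t (f n) = n ⊗ₜ[k] t f := by
  haveI : Nontrivial N := IsSimpleModule.nontrivial R N
  have h : (T5IsotypicHom.evEquiv hSchur hV).symm (f n) = n ⊗ₜ[k] f := by
    rw [LinearEquiv.symm_apply_eq, T5IsotypicHom.evEquiv_tmul]
  change mapLeft (R := R) (t.restrictScalars k) ((T5IsotypicHom.evEquiv hSchur hV).symm (f n)) =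
    n ⊗ₜ[k] t f
  rw [h, mapLeft_tmul]
  rfl

/-- `ofThetaHom t` is `R₂`-equivariant. -/
theorem ofThetaHom_equivariant (t : (N →ₗ[R] V) →ₗ[R₂] P) : IsTensorEquivariant R₂ (ofThetaHom hSchur hV t) := by
  haveI : Nontrivial N := IsSimpleModule.nontrivial R N
  intro r x
  set E := T5IsotypicHom.evEquiv hSchur hV with hE
  -- `E.symm (r • x) = (1 ⊗ (r • ·)) (E.symm x)`
  have h1 : E.symm (r • x) =
      TensorProduct.map LinearMap.id (DistribSMul.toLinearMap k (N →ₗ[R] V) r) (E.symm x) := by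
    rw [LinearEquiv.symm_apply_eq]
    have := T5IsotypicHom.evEquiv_postcomp hSchur hV (fun r : R₂ => DistribSMul.toLinearMap R V r)
      r (E.symm x)
    rw [T5HoweSmooth.smul_postcomp_eq] at this
    rw [this, LinearEquiv.apply_symm_apply]
    rfl
  change mapLeft (R := R) (t.restrictScalars k) (E.symm (r • x)) =
    TensorProduct.map LinearMap.id (DistribSMul.toLinearMap k P r)
      (mapLeft (R := R) (t.restrictScalars k) (E.symm x))
  rw [h1]
  generalize E.symm x = y
  induction y using TensorProduct.induction_on with
  | zero => simp
  | tmul n f =>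
    rw [TensorProduct.map_tmul, mapLeft_tmul, mapLeft_tmul, TensorProduct.map_tmul]
    change n ⊗ₜ[k] t (r • f) = n ⊗ₜ[k] (r • t f)
    rw [map_smul]
  | add y z hy hz =>
    rw [map_add, map_add, hy, hz, map_add, map_add]

/-- **From `Φ` to `t`**: the `R₂`-linear `t` with `Φ (f n) = n ⊗ t f`, extracted by
`T5SchurTensorEquivariance.exists_linear_equivariant` (chosen). -/
noncomputable def toThetaHom (Φ : V →ₗ[R] TensorProduct k N P) (hΦ : IsTensorEquivariant R₂ Φ) :
    (N →ₗ[R] V) →ₗ[R₂] P :=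
  haveI : Nontrivial N := IsSimpleModule.nontrivial R N
  let E := T5IsotypicHom.evEquiv hSchur hV
  let Ψ : TensorProduct k N (N →ₗ[R] V) →ₗ[R] TensorProduct k N P := Φ ∘ₗ (E : _ →ₗ[R] V)
  have hΨ : ∀ (r : R₂) (x : TensorProduct k N (N →ₗ[R] V)),
      Ψ (TensorProduct.map LinearMap.id (DistribSMul.toLinearMap k (N →ₗ[R] V) r) x) =
        TensorProduct.map LinearMap.id (DistribSMul.toLinearMap k P r) (Ψ x) := by
    intro r x
    have h1 := T5IsotypicHom.evEquiv_postcomp hSchur hV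
      (fun r : R₂ => DistribSMul.toLinearMap R V r) r x
    rw [T5HoweSmooth.smul_postcomp_eq] at h1
    change Φ (E (TensorProduct.map LinearMap.id (DistribSMul.toLinearMap k (N →ₗ[R] V) r) x)) =
      TensorProduct.map LinearMap.id (DistribSMul.toLinearMap k P r) (Φ (E x))
    rw [h1]
    exact hΦ r (E x)
  let t₀ := Classical.choose (T5SchurTensorEquivariance.exists_linear_equivariant hSchur Ψ
    (fun r : R₂ => DistribSMul.toLinearMap k (N →ₗ[R] V) r)
    (fun r : R₂ => DistribSMul.toLinearMap k P r) hΨ)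
  { toFun := t₀
    map_add' := map_add t₀
    map_smul' := fun r f => (Classical.choose_spec
      (T5SchurTensorEquivariance.exists_linear_equivariant hSchur Ψ
        (fun r : R₂ => DistribSMul.toLinearMap k (N →ₗ[R] V) r)
        (fun r : R₂ => DistribSMul.toLinearMap k P r) hΨ)).2 r f }

/-- `Φ (f n) = n ⊗ toThetaHom Φ f`. -/
theorem toThetaHom_spec (Φ : V →ₗ[R] TensorProduct k N P) (hΦ : IsTensorEquivariant R₂ Φ) (n : N)
    (f : N →ₗ[R] V) : Φ (f n) = n ⊗ₜ[k] toThetaHom hSchur hV Φ hΦ f := by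
  haveI : Nontrivial N := IsSimpleModule.nontrivial R N
  have h := (Classical.choose_spec (T5SchurTensorEquivariance.exists_linear_equivariant hSchur
    (Φ ∘ₗ ((T5IsotypicHom.evEquiv hSchur hV : _ ≃ₗ[R] V) : _ →ₗ[R] V))
    (fun r : R₂ => DistribSMul.toLinearMap k (N →ₗ[R] V) r)
    (fun r : R₂ => DistribSMul.toLinearMap k P r) (by
      intro r x
      have h1 := T5IsotypicHom.evEquiv_postcomp hSchur hV
        (fun r : R₂ => DistribSMul.toLinearMap R V r) r x
      rw [T5HoweSmooth.smul_postcomp_eq] at h1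
      change Φ ((T5IsotypicHom.evEquiv hSchur hV)
        (TensorProduct.map LinearMap.id (DistribSMul.toLinearMap k (N →ₗ[R] V) r) x)) =
        TensorProduct.map LinearMap.id (DistribSMul.toLinearMap k P r)
          (Φ ((T5IsotypicHom.evEquiv hSchur hV) x))
      rw [h1]
      exact hΦ r _))).1 n f
  change Φ ((T5IsotypicHom.evEquiv hSchur hV) (n ⊗ₜ[k] f)) = _ at h
  rw [T5IsotypicHom.evEquiv_tmul] at h
  exact h

/-- **Uniqueness of `t`**: any `R₂`-linear `t` with `Φ (f n) = n ⊗ t f` is `toThetaHom Φ`. -/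
theorem eq_toThetaHom_of_spec (Φ : V →ₗ[R] TensorProduct k N P) (hΦ : IsTensorEquivariant R₂ Φ)
    (t : (N →ₗ[R] V) →ₗ[R₂] P) (ht : ∀ (n : N) (f : N →ₗ[R] V), Φ (f n) = n ⊗ₜ[k] t f) :
    t = toThetaHom hSchur hV Φ hΦ := by
  haveI : Nontrivial N := IsSimpleModule.nontrivial R N
  obtain ⟨n₀, hn₀⟩ := exists_ne (0 : N)
  apply LinearMap.ext
  intro f
  apply T5SchurTensor.tmul_right_injective' (k := k) hn₀
  rw [← ht n₀ f, toThetaHom_spec hSchur hV Φ hΦ n₀ f]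

/-- `ofThetaHom (toThetaHom Φ) = Φ`. -/
theorem ofThetaHom_toThetaHom (Φ : V →ₗ[R] TensorProduct k N P) (hΦ : IsTensorEquivariant R₂ Φ) :
    ofThetaHom hSchur hV (toThetaHom hSchur hV Φ hΦ) = Φ := by
  haveI : Nontrivial N := IsSimpleModule.nontrivial R N
  apply LinearMap.ext
  intro v
  obtain ⟨x, rfl⟩ := (T5IsotypicHom.evEquiv hSchur hV).surjective v
  induction x using TensorProduct.induction_on with
  | zero => simp
  | tmul n f =>
    rw [T5IsotypicHom.evEquiv_tmul, ofThetaHom_apply, toThetaHom_spec hSchur hV Φ hΦ]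
  | add x y hx hy =>
    simp only [map_add, hx, hy]

/-- `toThetaHom (ofThetaHom t) = t`. -/
theorem toThetaHom_ofThetaHom (t : (N →ₗ[R] V) →ₗ[R₂] P) :
    toThetaHom hSchur hV (ofThetaHom hSchur hV t) (ofThetaHom_equivariant hSchur hV t) = t :=
  (eq_toThetaHom_of_spec hSchur hV _ _ t (ofThetaHom_apply hSchur hV t)).symm

/-- **The universal property of `Θ(N) = Hom_R(N, V)`**: `R₂`-equivariant `R`-maps `V → N ⊗[k] P`
correspond bijectively to `R₂`-maps `Θ(N) → P`, `Φ ↦ toThetaHom Φ`, `t ↦ ofThetaHom t`. -/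
noncomputable def thetaEquiv :
    {Φ : V →ₗ[R] TensorProduct k N P // IsTensorEquivariant R₂ Φ} ≃ ((N →ₗ[R] V) →ₗ[R₂] P) where
  toFun Φ := toThetaHom hSchur hV Φ.1 Φ.2
  invFun t := ⟨ofThetaHom hSchur hV t, ofThetaHom_equivariant hSchur hV t⟩
  left_inv Φ := Subtype.ext (ofThetaHom_toThetaHom hSchur hV Φ.1 Φ.2)
  right_inv t := toThetaHom_ofThetaHom hSchur hV t

/-- `thetaEquiv` on a pair. -/
theorem thetaEquiv_apply (Φ : {Φ : V →ₗ[R] TensorProduct k N P // IsTensorEquivariant R₂ Φ}) :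
    thetaEquiv hSchur hV Φ = toThetaHom hSchur hV Φ.1 Φ.2 := rfl

/-- `thetaEquiv.symm t = ofThetaHom t`. -/
theorem thetaEquiv_symm_apply (t : (N →ₗ[R] V) →ₗ[R₂] P) :
    ((thetaEquiv hSchur hV).symm t).1 = ofThetaHom hSchur hV t := rfl

end Adjunction

end Summit.Ventures.HodgeRepro2.T5ThetaAdjunction
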